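import Summits.QuantumFields.BalabanUV.Beta.FP.PeriodisedSymBorderWardContactTwo
import Summits.QuantumFields.BalabanUV.Beta.FP.PeriodisedSymBorderWardContactInstance

/-!
# `BalabanUV.Beta.FP.PeriodisedSymBorderWardContactTwoInstance` — road «FP», ROUTE T, binder row D1: **ROW `c2` OF THE (STEP) DOOR AT THE TORUS, BY TERM**

The ORDER-2 insertion-table covariance row of `NestedStepLawTorusTransportedRowsGradedLevelZeroSymULowClosedLamW2Q2` (U21, there a DISPLAYED binder
`c2 : Q₁₂ h h * fromCols D₂ D₁ + 2 • (Q₁₁ h * W₁) + Q₁₀ * W₂ = fromCols Db₂ 0`) is a THEOREM of the objects of record, with the coarse second jet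
**`Db₂((p̄,m), t̄) = c_j³ · ((Q₁₀ h)(p̄,m))² · [t̄ = p̄ + e_m]`** — the sym twin ONE ORDER UP of `PeriodisedSymBorderWardContactInstance.torus_c1_symVhSAt_weighted`.

WHAT ([folklore] finite sums BY NAME over leaf-02's chain G3′σ → G4-B′σ → (P) → `PeriodisedSymBorderWardContactTwo` (the second-bond-periodised (0.4) row table
`Σ'_n symVh₂SAn1 3 Lc κ u κ′ (u′ + F∘n)` against a torus gauge-mode column = four contact terms in the letters `Q₁₁^{b}`, `Q₁₁^{b′}`, `Q₁₀`), and the c1 instance's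
torus plumbing (`tgradBlock_eq_sum_tgrad_mul`, `sum_tdelta_mul`, `tdelta_quo_wrapPt`, `quo_zsmul_add_toSite'`, `tdelta_far_eq_zero_of_not_root`)):
§1 **`symQ12_mul_tgrad_apply`** (per ordered pair of torus bonds `(b, b′)`, ANY column map), **`symQ12_mul_D2_apply`** (the block-constant block: tips read through
`quo Lc`, the far root reads the NEXT coarse site `p̄ + e_m`); §2 **`c2_entry_algebra`** (the finite algebra: the two tip terms are symmetric under `b ↔ b′` and cancel
`2 • (Q₁₁ h * W₁)`, the diagonal term cancels `Q₁₀ * W₂`, the far-root term is the square); §3 **`torus_c2_sym_weighted`** — row `c2` for ANY bond weight `h`, in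
the exact binder shapes of U21 (`hQ₁₀ hQ₁₁ hW₁₂ hQ₁₂ hW₁ hW₂ hD₁ hD₂`, level `j`).  Numerically concordant with Engine C's C2-DET (RELAY 225: right block `0`
exactly, far-root column `c₀³·Q₁₀(a,β)Q₁₀(a,β′)`, 104 976 ordered pairs at `(4,3)`).  No `def`, no `def … : Prop`, nothing cited, 0 sorry.

HONEST DEPENDENCY (page 1, mandatory): continuum YM on T⁴ ⇐ BetaPertH ∧ nine spine estimates (0/9 proved); BetaPertH ⇐ (D1) ∧ (D4) ∧ CAP+tail;
G-an2-4 gates asym, D1 and NE2/3/4.  HONEST FRAMING (cell contract, verbatim): «discharging `BetaPertH` makes Bałaban's UV stability UNCONDITIONAL —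
a real constructive-QFT result; it is NOT the continuum limit and NOT the Clay problem.»  ABSOLUTE RULE (cell charter, verbatim): «No internally-minted
statement may enter as a cited fact. Every hypothesis is either kernel-proved in this package or a verbatim quotation of a PUBLISHED theorem with page
reference. The manuscript(s) under audit are NOT citable for their own disputed steps — they are the thing under adjudication; programme-internal
(2001/route/tribunal) claims are never citable.»  0 estimates; 0∕4 row-D1 binders (hW, hR, D1Tel, D1Rep); NOT (T-ID), NOT (J-a) complete, NOT SDF, NOT D1,
NOT BetaPertH, NOT continuum, NOT Clay; row `d2` and the composite rows stay DISPLAYED.  D1 formalisation swarm LEAF PROVER 02 (b2b-balaban-beta-d1-formalise-leaf-02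
gen 23), 2026-08-23.  No existing file touched.
-/

noncomputable section

open scoped BigOperators

namespace Summit.QuantumFields.BalabanUV.Beta.FP.PeriodisedSymBorderWardContactTwoInstance

open Finset Matrix
open Literature.Probability.LatticeModels (Torus.proj)
open Literature.MathematicalPhysics.QuantumFieldTheory.Balaban1983to89
open Literature.MathematicalPhysics.QuantumFieldTheory.Balaban1983to89.Beta
open Literature.MathematicalPhysics.QuantumFieldTheory.LatticeForm (quo)
open B4TorusKernel.MultiPeriod (translate)
open B5Prop11Plancherel (fine)
open B6Lemma24Torus (pbox)
open ExpKernelCalculus (MKer)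
open AffineAveraging (Site box toSite unitVec)
open AveragingContoursRooted (ctr ctrOff ctrOff_mem_box)
open OneStepResolventKernel (Fib)
open Summit.QuantumFields.BalabanUV.Beta.BorderedHessian (stepScale)
open Summit.QuantumFields.BalabanUV.Beta.DshAn1 (Dsh)
open Summit.QuantumFields.BalabanUV.Beta.SymAveragingHessianCounts (symVhSAt)
open Summit.QuantumFields.BalabanUV.Beta.SymShiftedSpread (bhKStepSh)
open Summit.QuantumFields.BalabanUV.Beta.SymSecondOrderTablesAn1 (symVh₂SAn1)
open Summit.QuantumFields.BalabanUV.Beta.FP.KernelPeriodisationFib (Idx perF)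
open Summit.QuantumFields.BalabanUV.Beta.FP.KernelPeriodisationFibLoc (dper)
open Summit.QuantumFields.BalabanUV.Beta.FP.TorusGaugeCovariance (tdelta tgrad)
open Summit.QuantumFields.BalabanUV.Beta.FP.TorusGaugeCovariancePairing (sum_tdelta_mul)
open Summit.QuantumFields.BalabanUV.Beta.FP.TorusGaugeCovarianceCoarse (tgradBlock tgradBlock_eq_sum_tgrad_mul coarsePt coarsePt_coe proj_coarsePt
  tdelta_quo_wrapPt quo_zsmul_add_toSite')
open Summit.QuantumFields.BalabanUV.Beta.FP.TorusCombRows (Res ne_rootOf_iff_proj_ne)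
open Summit.QuantumFields.BalabanUV.Beta.GAN24.FineReadoutCauchyFrame (toSite_mem_range)
open Summit.QuantumFields.BalabanUV.Beta.FP.PeriodisedBorderWardContact (tdelta_far_eq_zero_of_not_root)
open Summit.QuantumFields.BalabanUV.Beta.FP.PeriodisedSymBorderWardContactTwo (submatrix_borderT2per_mul_tgrad)

variable {d : ℕ} (M' : Fin (3 + 1) → ℕ) [∀ μ, NeZero (M' μ)] {Lc : ℕ} [NeZero Lc] {r' : Fin (3 + 1) → ℕ}

/-! ## §1 The per-pair blocks of `Q₁₂^{b,b′} · [D₂ | D₁]` -/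

omit [∀ μ, NeZero (M' μ)] [NeZero Lc] in
/-- [folklore] two torus bonds are equal iff their (direction, site) pairs are. -/
theorem ite_bond_eq (b b' : ↥(pbox (fine Lc M')) × Fin (3 + 1)) :
    (if (b.2, (b.1 : Site (3 + 1))) = (b'.2, (b'.1 : Site (3 + 1))) then (1 : ℝ) else 0) = if b = b' then (1 : ℝ) else 0 := by
  by_cases hb : b = b'
  · subst hb; rw [if_pos rfl, if_pos rfl]
  · rw [if_neg hb, if_neg fun e => hb ?_]
    obtain ⟨h2, h1⟩ := Prod.mk.inj e
    exact Prod.ext (Subtype.ext h1) h2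

/-- [folklore] **`symQ12_mul_tgrad_apply` — THE PER-PAIR ENTRY OF `Q₁₂^{b,b′} · D` AT THE (III′) TORUS CALL, ANY COLUMN MAP `g`** (`F = fine Lc M′`, root `ρ_c`,
multiplier rows `a ↦ (coarsePt M′ Lc a.1, inr a.2)`): with `Q₁₂^{b,b′} := (perF F (dper F (W b′.2 ↑b′.1 b.2 ↑b.1))).submatrix …` (U21's `hW₁₂`),
`Q₁₁^{b} := perF F (dper F (symVhSAt ρ_c 3 Lc rfl b.2 ↑b.1))`, `Q₁₀ := perF F 𝕄_j` (`𝕄_j = bhKStepSh 3 Lc (Dsh Lc) j`), `c_j = (Lc⁴·stepScale 3 Lc j)⁻¹`: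
`(Q₁₂^{b,b′}·D)(a, c) = −( tdelta F (tip b′) (g c)·Q₁₁^{b}(a,b′) + tdelta F (tip b) (g c)·Q₁₁^{b′}(a,b) − tdelta F (tip b) (g c)·[b = b′]·c_j·Q₁₀(a,b)
+ tdelta F (coarsePt a.1 + ρ_c + Lc•e_{a.2}) (g c)·(c_j Q₁₀(a,b))·(c_j Q₁₀(a,b′)) )`. -/
theorem symQ12_mul_tgrad_apply (j : ℕ)
    {W : Fin (3 + 1) → Site (3 + 1) → Fin (3 + 1) → Site (3 + 1) → MKer (3 + 1) (Fib 3)}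
    (hW : W = fun κ' u' κ u x z a c => ∑' n : Site (3 + 1), symVh₂SAn1 3 Lc κ u κ' (translate (fine Lc M') u' n) x z a c)
    (b b' : ↥(pbox (fine Lc M')) × Fin (3 + 1)) {γ : Type*} (g : γ → ↥(pbox (fine Lc M'))) (a : ↥(pbox M') × Fin (3 + 1)) (c : γ) :
    ((perF (fine Lc M') (dper (fine Lc M') (W b'.2 (b'.1 : Site (3 + 1)) b.2 (b.1 : Site (3 + 1))))).submatrix
          (fun a : ↥(pbox M') × Fin (3 + 1) => ((coarsePt M' Lc a.1, Sum.inr a.2) : Idx (fine Lc M') (Fib 3)))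
          (fun b : ↥(pbox (fine Lc M')) × Fin (3 + 1) => ((b.1, Sum.inl b.2) : Idx (fine Lc M') (Fib 3)))
        * (tgrad (fine Lc M')).submatrix (fun b : ↥(pbox (fine Lc M')) × Fin (3 + 1) => ((b.1, Sum.inl b.2) : Idx (fine Lc M') (Fib 3))) g) a c
      = -(tdelta (fine Lc M') ((b'.1 : Site (3 + 1)) + unitVec b'.2) (g c)
            * perF (fine Lc M') (dper (fine Lc M') (symVhSAt (ctr (3 + 1) Lc) 3 Lc rfl b.2 (b.1 : Site (3 + 1)))) (coarsePt M' Lc a.1, Sum.inr a.2) (b'.1, Sum.inl b'.2)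
          + tdelta (fine Lc M') ((b.1 : Site (3 + 1)) + unitVec b.2) (g c)
            * perF (fine Lc M') (dper (fine Lc M') (symVhSAt (ctr (3 + 1) Lc) 3 Lc rfl b'.2 (b'.1 : Site (3 + 1)))) (coarsePt M' Lc a.1, Sum.inr a.2) (b.1, Sum.inl b.2)
          - tdelta (fine Lc M') ((b.1 : Site (3 + 1)) + unitVec b.2) (g c) * ((if b = b' then (1 : ℝ) else 0)
              * (((Lc : ℝ) ^ (3 + 1) * stepScale 3 Lc j)⁻¹ * perF (fine Lc M') (bhKStepSh 3 Lc (Dsh Lc) j) (coarsePt M' Lc a.1, Sum.inr a.2) (b.1, Sum.inl b.2)))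
          + tdelta (fine Lc M') ((coarsePt M' Lc a.1 : Site (3 + 1)) + ctr (3 + 1) Lc + (Lc : ℤ) • unitVec a.2) (g c)
              * ((((Lc : ℝ) ^ (3 + 1) * stepScale 3 Lc j)⁻¹ * perF (fine Lc M') (bhKStepSh 3 Lc (Dsh Lc) j) (coarsePt M' Lc a.1, Sum.inr a.2) (b.1, Sum.inl b.2))
                * (((Lc : ℝ) ^ (3 + 1) * stepScale 3 Lc j)⁻¹ * perF (fine Lc M') (bhKStepSh 3 Lc (Dsh Lc) j) (coarsePt M' Lc a.1, Sum.inr a.2) (b'.1, Sum.inl b'.2)))) := by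
  have hV : W b'.2 (b'.1 : Site (3 + 1)) = fun κ u x z a c => ∑' n : Site (3 + 1), symVh₂SAn1 3 Lc κ u b'.2 (translate (fine Lc M') (b'.1 : Site (3 + 1)) n) x z a c := by
    subst hW; rfl
  have h := submatrix_borderT2per_mul_tgrad b'.2 (b'.1 : Site (3 + 1)) (M := fine Lc M') (M' := M') (fun _ => rfl) hV b'.1.2 j
    (fun a : ↥(pbox M') × Fin (3 + 1) => (coarsePt M' Lc a.1 : Site (3 + 1))) (fun a => (coarsePt M' Lc a.1).2) (fun a => a.2) g b.2 b.1 a c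
  rw [ite_bond_eq] at h
  exact h

/-- [folklore] **`symQ12_mul_D2_apply` — THE BLOCK-CONSTANT BLOCK** (sym twin one order up of `symQ11_mul_D2_apply`): against the coarse block gauge modes
`D₂ = tgradBlock M′ Lc ∘ …` the tips read through `quo Lc` and the far root reads the NEXT coarse site:
`(Q₁₂^{b,b′}·D₂)(a, t̄) = −( tdelta M′ (quo Lc (tip b′)) t̄·Q₁₁^{b}(a,b′) + tdelta M′ (quo Lc (tip b)) t̄·Q₁₁^{b′}(a,b) − tdelta M′ (quo Lc (tip b)) t̄·[b = b′]·c_j·Q₁₀(a,b)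
+ tdelta M′ (a.1 + e_{a.2}) t̄·(c_j Q₁₀(a,b))·(c_j Q₁₀(a,b′)) )`. -/
theorem symQ12_mul_D2_apply (j : ℕ)
    {W : Fin (3 + 1) → Site (3 + 1) → Fin (3 + 1) → Site (3 + 1) → MKer (3 + 1) (Fib 3)}
    (hW : W = fun κ' u' κ u x z a c => ∑' n : Site (3 + 1), symVh₂SAn1 3 Lc κ u κ' (translate (fine Lc M') u' n) x z a c)
    {D₂ : Matrix (↥(pbox (fine Lc M')) × Fin (3 + 1)) (Res (toSite r') Lc M') ℝ}
    (hD₂ : D₂ = (tgradBlock M' Lc).submatrix (fun b : ↥(pbox (fine Lc M')) × Fin (3 + 1) => ((b.1, Sum.inl b.2) : Idx (fine Lc M') (Fib 3)))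
        (Subtype.val : Res (toSite r') Lc M' → ↥(pbox M')))
    (b b' : ↥(pbox (fine Lc M')) × Fin (3 + 1)) (a : ↥(pbox M') × Fin (3 + 1)) (t : Res (toSite r') Lc M') :
    ((perF (fine Lc M') (dper (fine Lc M') (W b'.2 (b'.1 : Site (3 + 1)) b.2 (b.1 : Site (3 + 1))))).submatrix
          (fun a : ↥(pbox M') × Fin (3 + 1) => ((coarsePt M' Lc a.1, Sum.inr a.2) : Idx (fine Lc M') (Fib 3)))
          (fun b : ↥(pbox (fine Lc M')) × Fin (3 + 1) => ((b.1, Sum.inl b.2) : Idx (fine Lc M') (Fib 3))) * D₂) a t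
      = -(tdelta M' (quo Lc ((b'.1 : Site (3 + 1)) + unitVec b'.2)) t.1
            * perF (fine Lc M') (dper (fine Lc M') (symVhSAt (ctr (3 + 1) Lc) 3 Lc rfl b.2 (b.1 : Site (3 + 1)))) (coarsePt M' Lc a.1, Sum.inr a.2) (b'.1, Sum.inl b'.2)
          + tdelta M' (quo Lc ((b.1 : Site (3 + 1)) + unitVec b.2)) t.1
            * perF (fine Lc M') (dper (fine Lc M') (symVhSAt (ctr (3 + 1) Lc) 3 Lc rfl b'.2 (b'.1 : Site (3 + 1)))) (coarsePt M' Lc a.1, Sum.inr a.2) (b.1, Sum.inl b.2)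
          - tdelta M' (quo Lc ((b.1 : Site (3 + 1)) + unitVec b.2)) t.1 * ((if b = b' then (1 : ℝ) else 0)
              * (((Lc : ℝ) ^ (3 + 1) * stepScale 3 Lc j)⁻¹ * perF (fine Lc M') (bhKStepSh 3 Lc (Dsh Lc) j) (coarsePt M' Lc a.1, Sum.inr a.2) (b.1, Sum.inl b.2)))
          + tdelta M' ((a.1 : Site (3 + 1)) + unitVec a.2) t.1
              * ((((Lc : ℝ) ^ (3 + 1) * stepScale 3 Lc j)⁻¹ * perF (fine Lc M') (bhKStepSh 3 Lc (Dsh Lc) j) (coarsePt M' Lc a.1, Sum.inr a.2) (b.1, Sum.inl b.2))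
                * (((Lc : ℝ) ^ (3 + 1) * stepScale 3 Lc j)⁻¹ * perF (fine Lc M') (bhKStepSh 3 Lc (Dsh Lc) j) (coarsePt M' Lc a.1, Sum.inr a.2) (b'.1, Sum.inl b'.2)))) := by
  have hLc1 : 1 ≤ Lc := Nat.one_le_iff_ne_zero.mpr (NeZero.ne Lc)
  subst hD₂
  set Q12 := (perF (fine Lc M') (dper (fine Lc M') (W b'.2 (b'.1 : Site (3 + 1)) b.2 (b.1 : Site (3 + 1))))).submatrix
          (fun a : ↥(pbox M') × Fin (3 + 1) => ((coarsePt M' Lc a.1, Sum.inr a.2) : Idx (fine Lc M') (Fib 3)))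
          (fun b : ↥(pbox (fine Lc M')) × Fin (3 + 1) => ((b.1, Sum.inl b.2) : Idx (fine Lc M') (Fib 3))) with hQ12
  -- expand the block column over the `tgrad` columns and exchange the finite sums
  have hx : (Q12 * (tgradBlock M' Lc).submatrix (fun b : ↥(pbox (fine Lc M')) × Fin (3 + 1) => ((b.1, Sum.inl b.2) : Idx (fine Lc M') (Fib 3)))
        (Subtype.val : Res (toSite r') Lc M' → ↥(pbox M'))) a t
      = ∑ s : ↥(pbox (fine Lc M')), (Q12 * (tgrad (fine Lc M')).submatrix
            (fun b : ↥(pbox (fine Lc M')) × Fin (3 + 1) => ((b.1, Sum.inl b.2) : Idx (fine Lc M') (Fib 3))) id) a s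
          * tdelta M' (quo Lc (s : Site (3 + 1))) t.1 := by
    simp only [Matrix.mul_apply, Matrix.submatrix_apply, id_eq, tgradBlock_eq_sum_tgrad_mul, Finset.mul_sum, Finset.sum_mul, mul_assoc]
    exact Finset.sum_comm
  refine hx.trans ?_
  rw [Finset.sum_congr rfl fun s _ => by rw [hQ12, symQ12_mul_tgrad_apply M' j hW b b' id a s]]
  -- name the four column-independent factors and pair each periodic indicator with the block indicator
  set A := perF (fine Lc M') (dper (fine Lc M') (symVhSAt (ctr (3 + 1) Lc) 3 Lc rfl b.2 (b.1 : Site (3 + 1)))) (coarsePt M' Lc a.1, Sum.inr a.2) (b'.1, Sum.inl b'.2)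
  set B := perF (fine Lc M') (dper (fine Lc M') (symVhSAt (ctr (3 + 1) Lc) 3 Lc rfl b'.2 (b'.1 : Site (3 + 1)))) (coarsePt M' Lc a.1, Sum.inr a.2) (b.1, Sum.inl b.2)
  set C := (if b = b' then (1 : ℝ) else 0)
      * (((Lc : ℝ) ^ (3 + 1) * stepScale 3 Lc j)⁻¹ * perF (fine Lc M') (bhKStepSh 3 Lc (Dsh Lc) j) (coarsePt M' Lc a.1, Sum.inr a.2) (b.1, Sum.inl b.2))
  set D := (((Lc : ℝ) ^ (3 + 1) * stepScale 3 Lc j)⁻¹ * perF (fine Lc M') (bhKStepSh 3 Lc (Dsh Lc) j) (coarsePt M' Lc a.1, Sum.inr a.2) (b.1, Sum.inl b.2))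
      * (((Lc : ℝ) ^ (3 + 1) * stepScale 3 Lc j)⁻¹ * perF (fine Lc M') (bhKStepSh 3 Lc (Dsh Lc) j) (coarsePt M' Lc a.1, Sum.inr a.2) (b'.1, Sum.inl b'.2))
  have hre : ∀ s : ↥(pbox (fine Lc M')),
      -(tdelta (fine Lc M') ((b'.1 : Site (3 + 1)) + unitVec b'.2) (id s) * A + tdelta (fine Lc M') ((b.1 : Site (3 + 1)) + unitVec b.2) (id s) * B
          - tdelta (fine Lc M') ((b.1 : Site (3 + 1)) + unitVec b.2) (id s) * C
          + tdelta (fine Lc M') ((coarsePt M' Lc a.1 : Site (3 + 1)) + ctr (3 + 1) Lc + (Lc : ℤ) • unitVec a.2) (id s) * D)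
        * tdelta M' (quo Lc (s : Site (3 + 1))) t.1
      = -(A * (tdelta (fine Lc M') ((b'.1 : Site (3 + 1)) + unitVec b'.2) s * tdelta M' (quo Lc (s : Site (3 + 1))) t.1)
          + B * (tdelta (fine Lc M') ((b.1 : Site (3 + 1)) + unitVec b.2) s * tdelta M' (quo Lc (s : Site (3 + 1))) t.1)
          - C * (tdelta (fine Lc M') ((b.1 : Site (3 + 1)) + unitVec b.2) s * tdelta M' (quo Lc (s : Site (3 + 1))) t.1)
          + D * (tdelta (fine Lc M') ((coarsePt M' Lc a.1 : Site (3 + 1)) + ctr (3 + 1) Lc + (Lc : ℤ) • unitVec a.2) s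
              * tdelta M' (quo Lc (s : Site (3 + 1))) t.1)) := fun s => by simp only [id_eq]; ring
  rw [Finset.sum_congr rfl fun s _ => hre s]
  simp only [Finset.sum_neg_distrib, Finset.sum_add_distrib, Finset.sum_sub_distrib, ← Finset.mul_sum, sum_tdelta_mul, tdelta_quo_wrapPt]
  rw [coarsePt_coe, show (Lc : ℤ) • (a.1 : Site (3 + 1)) + ctr (3 + 1) Lc + (Lc : ℤ) • unitVec a.2
      = (Lc : ℤ) • ((a.1 : Site (3 + 1)) + unitVec a.2) + ctr (3 + 1) Lc by rw [smul_add]; abel,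
    show ctr (3 + 1) Lc = toSite (ctrOff (3 + 1) Lc) from rfl, quo_zsmul_add_toSite' (ctrOff_mem_box hLc1)]
  ring

/-! ## §2 The finite algebra of row `c2` -/

/-- [folklore] **the finite algebra of row `c2`**: with `P b b′ = Q₁₁^{b}(a,b′)`, `q b = Q₁₀(a,b)`, `τ b` the tip indicator of `b` at the column and `r` the
far-root indicator, the `b ↔ b′`-symmetric tip terms cancel `2 • (Q₁₁ h * W₁)`, the diagonal cancels `Q₁₀ * W₂`, and the far root is the square. -/
theorem c2_entry_algebra {β : Type*} [Fintype β] [DecidableEq β] (h τ q : β → ℝ) (P : β → β → ℝ) (c r : ℝ) :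
    -c * (∑ b, ∑ b', h b * h b' * -(τ b' * P b b' + τ b * P b' b - τ b * ((if b = b' then (1 : ℝ) else 0) * (c * q b))
          + r * ((c * q b) * (c * q b'))))
        + 2 * (∑ b', (∑ b, h b * P b b') * (h b' * -(c * τ b')))
        + ∑ b, q b * ((c * h b) ^ 2 * τ b)
      = c ^ 3 * (∑ b, q b * h b) ^ 2 * r := by
  have e1 : ∑ b, ∑ b', h b * h b' * -(τ b' * P b b' + τ b * P b' b - τ b * ((if b = b' then (1 : ℝ) else 0) * (c * q b))
        + r * ((c * q b) * (c * q b')))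
      = -(∑ b, ∑ b', h b * h b' * (τ b' * P b b')) - (∑ b, ∑ b', h b * h b' * (τ b * P b' b))
        + c * ∑ b, h b ^ 2 * (τ b * q b) - r * c ^ 2 * (∑ b, q b * h b) ^ 2 := by
    have hd : ∀ b, ∑ b', h b * h b' * (τ b * ((if b = b' then (1 : ℝ) else 0) * (c * q b))) = c * (h b ^ 2 * (τ b * q b)) := fun b => by
      rw [Finset.sum_eq_single b (fun b' _ hb' => by rw [if_neg (Ne.symm hb')]; ring) (fun hb => absurd (Finset.mem_univ b) hb), if_pos rfl]
      ring
    have hsq : ∑ b, ∑ b', h b * h b' * (r * ((c * q b) * (c * q b'))) = r * c ^ 2 * (∑ b, q b * h b) ^ 2 := by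
      rw [show (∑ b, q b * h b) ^ 2 = (∑ b, q b * h b) * ∑ b, q b * h b from sq _, Finset.sum_mul_sum, Finset.mul_sum]
      refine Finset.sum_congr rfl fun b _ => ?_
      rw [Finset.mul_sum]
      exact Finset.sum_congr rfl fun b' _ => by ring
    simp only [mul_neg, Finset.sum_neg_distrib, mul_add, mul_sub, Finset.sum_add_distrib, Finset.sum_sub_distrib, hd, hsq, ← Finset.mul_sum]
    ring
  have e2 : ∑ b, ∑ b', h b * h b' * (τ b * P b' b) = ∑ b, ∑ b', h b * h b' * (τ b' * P b b') := by
    rw [Finset.sum_comm]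
    exact Finset.sum_congr rfl fun b _ => Finset.sum_congr rfl fun b' _ => by ring
  have e3 : ∑ b', (∑ b, h b * P b b') * (h b' * -(c * τ b')) = -c * ∑ b, ∑ b', h b * h b' * (τ b' * P b b') := by
    rw [Finset.sum_comm, Finset.mul_sum]
    refine Finset.sum_congr rfl fun b' _ => ?_
    rw [Finset.sum_mul, Finset.mul_sum]
    exact Finset.sum_congr rfl fun b _ => by ring
  have e4 : ∑ b, q b * ((c * h b) ^ 2 * τ b) = c ^ 2 * ∑ b, h b ^ 2 * (τ b * q b) := by
    rw [Finset.mul_sum]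
    exact Finset.sum_congr rfl fun b _ => by ring
  rw [e1, e2, e3, e4]
  ring

/-! ## §3 Row `c2` of the (STEP) door at the torus, any bond weight -/

/-- [folklore] **`torus_c2_sym_weighted` — ROW `c2` OF U21 AT THE (III′) TORUS CALL, BY TERM, FOR ANY BOND WEIGHT `h`** (level `j`; `F = fine Lc M′`, root `ρ_c`,
`c_j = (Lc⁴·stepScale 3 Lc j)⁻¹`): with the objects of record by their defining equations — `Q₁₀` (the shifted spread's averaging rows), `Q₁₁ w` (the weighted
first-order border members), `W₁₂`∕`Q₁₂ w w′` (the second-bond-periodised (0.4) row table and its weighted bi-member, U21's `hW₁₂ hQ₁₂`), the ultralocal generator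
jets `W₁ W₂` (U21's `hW₁ hW₂`), the gauge columns `D₁` (residual) and `D₂` (coarse blocks) —
`Q₁₂ h h * fromCols D₂ D₁ + 2 • (Q₁₁ h * W₁) + Q₁₀ * W₂ = fromCols Db₂ 0`, **`Db₂((p̄,m), t̄) = c_j³ · (Σ_b Q₁₀((p̄,m), b)·h b)² · tdelta M′ (p̄ + e_m) t̄`**. -/
theorem torus_c2_sym_weighted (j : ℕ) (h : ↥(pbox (fine Lc M')) × Fin (3 + 1) → ℝ)
    {Q₁₀ : Matrix (↥(pbox M') × Fin (3 + 1)) (↥(pbox (fine Lc M')) × Fin (3 + 1)) ℝ}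
    (hQ₁₀ : Q₁₀ = (perF (fine Lc M') (bhKStepSh 3 Lc (Dsh Lc) j)).submatrix
        (fun a : ↥(pbox M') × Fin (3 + 1) => ((coarsePt M' Lc a.1, Sum.inr a.2) : Idx (fine Lc M') (Fib 3)))
        (fun b : ↥(pbox (fine Lc M')) × Fin (3 + 1) => ((b.1, Sum.inl b.2) : Idx (fine Lc M') (Fib 3))))
    (Q₁₁ : (↥(pbox (fine Lc M')) × Fin (3 + 1) → ℝ) → Matrix (↥(pbox M') × Fin (3 + 1)) (↥(pbox (fine Lc M')) × Fin (3 + 1)) ℝ)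
    (hQ₁₁ : ∀ w, Q₁₁ w = ∑ b : ↥(pbox (fine Lc M')) × Fin (3 + 1), w b •
        (perF (fine Lc M') (dper (fine Lc M') (symVhSAt (ctr (3 + 1) Lc) 3 Lc rfl b.2 (b.1 : Site (3 + 1))))).submatrix
          (fun a : ↥(pbox M') × Fin (3 + 1) => ((coarsePt M' Lc a.1, Sum.inr a.2) : Idx (fine Lc M') (Fib 3)))
          (fun b : ↥(pbox (fine Lc M')) × Fin (3 + 1) => ((b.1, Sum.inl b.2) : Idx (fine Lc M') (Fib 3))))
    {W₁₂ : Fin (3 + 1) → Site (3 + 1) → Fin (3 + 1) → Site (3 + 1) → MKer (3 + 1) (Fib 3)}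
    (hW₁₂ : W₁₂ = fun κ' u' κ u x z a c => ∑' n : Site (3 + 1), symVh₂SAn1 3 Lc κ u κ' (translate (fine Lc M') u' n) x z a c)
    (Q₁₂ : (↥(pbox (fine Lc M')) × Fin (3 + 1) → ℝ) → (↥(pbox (fine Lc M')) × Fin (3 + 1) → ℝ)
      → Matrix (↥(pbox M') × Fin (3 + 1)) (↥(pbox (fine Lc M')) × Fin (3 + 1)) ℝ)
    (hQ₁₂ : ∀ w w', Q₁₂ w w' = -(((Lc : ℝ) ^ (3 + 1) * stepScale 3 Lc j)⁻¹) • ∑ b : ↥(pbox (fine Lc M')) × Fin (3 + 1),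
        ∑ b' : ↥(pbox (fine Lc M')) × Fin (3 + 1), (w b * w' b') •
          (perF (fine Lc M') (dper (fine Lc M') (W₁₂ b'.2 (b'.1 : Site (3 + 1)) b.2 (b.1 : Site (3 + 1))))).submatrix
            (fun a : ↥(pbox M') × Fin (3 + 1) => ((coarsePt M' Lc a.1, Sum.inr a.2) : Idx (fine Lc M') (Fib 3)))
            (fun c : ↥(pbox (fine Lc M')) × Fin (3 + 1) => ((c.1, Sum.inl c.2) : Idx (fine Lc M') (Fib 3))))
    {W₁ : Matrix (↥(pbox (fine Lc M')) × Fin (3 + 1)) (Res (toSite r') Lc M' ⊕ Res (ctr (3 + 1) Lc) Lc (fine Lc M')) ℝ}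
    (hW₁ : W₁ = ∑ b : ↥(pbox (fine Lc M')) × Fin (3 + 1), h b •
        Matrix.of (fun (b' : ↥(pbox (fine Lc M')) × Fin (3 + 1)) (e : Res (toSite r') Lc M' ⊕ Res (ctr (3 + 1) Lc) Lc (fine Lc M')) =>
          if b' = b then
            -((((Lc : ℝ) ^ (3 + 1) * stepScale 3 Lc j)⁻¹)
              * Sum.elim (fun t : Res (toSite r') Lc M' => tdelta M' (quo Lc ((b.1 : Site (3 + 1)) + unitVec b.2)) t.1)
                  (fun s : Res (ctr (3 + 1) Lc) Lc (fine Lc M') => tdelta (fine Lc M') ((b.1 : Site (3 + 1)) + unitVec b.2) s.1) e)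
          else 0))
    {W₂ : Matrix (↥(pbox (fine Lc M')) × Fin (3 + 1)) (Res (toSite r') Lc M' ⊕ Res (ctr (3 + 1) Lc) Lc (fine Lc M')) ℝ}
    (hW₂ : W₂ = Matrix.of fun (b : ↥(pbox (fine Lc M')) × Fin (3 + 1)) (e : Res (toSite r') Lc M' ⊕ Res (ctr (3 + 1) Lc) Lc (fine Lc M')) =>
        ((((Lc : ℝ) ^ (3 + 1) * stepScale 3 Lc j)⁻¹) * h b) ^ 2 * Sum.elim (fun t : Res (toSite r') Lc M' => tdelta M' (quo Lc ((b.1 : Site (3 + 1)) + unitVec b.2)) t.1)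
          (fun s : Res (ctr (3 + 1) Lc) Lc (fine Lc M') => tdelta (fine Lc M') ((b.1 : Site (3 + 1)) + unitVec b.2) s.1) e)
    {D₁ : Matrix (↥(pbox (fine Lc M')) × Fin (3 + 1)) (Res (ctr (3 + 1) Lc) Lc (fine Lc M')) ℝ}
    (hD₁ : D₁ = (tgrad (fine Lc M')).submatrix (fun b : ↥(pbox (fine Lc M')) × Fin (3 + 1) => ((b.1, Sum.inl b.2) : Idx (fine Lc M') (Fib 3)))
        (Subtype.val : Res (ctr (3 + 1) Lc) Lc (fine Lc M') → ↥(pbox (fine Lc M'))))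
    {D₂ : Matrix (↥(pbox (fine Lc M')) × Fin (3 + 1)) (Res (toSite r') Lc M') ℝ}
    (hD₂ : D₂ = (tgradBlock M' Lc).submatrix (fun b : ↥(pbox (fine Lc M')) × Fin (3 + 1) => ((b.1, Sum.inl b.2) : Idx (fine Lc M') (Fib 3)))
        (Subtype.val : Res (toSite r') Lc M' → ↥(pbox M'))) :
    Q₁₂ h h * fromCols D₂ D₁ + (2 : ℝ) • (Q₁₁ h * W₁) + Q₁₀ * W₂
      = fromCols
          (Matrix.of fun (a : ↥(pbox M') × Fin (3 + 1)) (t : Res (toSite r') Lc M') =>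
            (((Lc : ℝ) ^ (3 + 1) * stepScale 3 Lc j)⁻¹) ^ 3 * (∑ b : ↥(pbox (fine Lc M')) × Fin (3 + 1), Q₁₀ a b * h b) ^ 2
              * tdelta M' ((a.1 : Site (3 + 1)) + unitVec a.2) t.1)
          (0 : Matrix (↥(pbox M') × Fin (3 + 1)) (Res (ctr (3 + 1) Lc) Lc (fine Lc M')) ℝ) := by
  have hLc : 0 < Lc := Nat.pos_of_ne_zero (NeZero.ne Lc)
  have hLc1 : 1 ≤ Lc := hLc
  have hM' : ∀ i, Lc ∣ fine Lc M' i := fun i => ⟨M' i, rfl⟩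
  -- the three products at the matrix ∕ entry level
  have hA : Q₁₂ h h * fromCols D₂ D₁ = -(((Lc : ℝ) ^ (3 + 1) * stepScale 3 Lc j)⁻¹) • ∑ b : ↥(pbox (fine Lc M')) × Fin (3 + 1), ∑ b' : ↥(pbox (fine Lc M')) × Fin (3 + 1), (h b * h b') •
      ((perF (fine Lc M') (dper (fine Lc M') (W₁₂ b'.2 (b'.1 : Site (3 + 1)) b.2 (b.1 : Site (3 + 1))))).submatrix
            (fun a : ↥(pbox M') × Fin (3 + 1) => ((coarsePt M' Lc a.1, Sum.inr a.2) : Idx (fine Lc M') (Fib 3)))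
            (fun c : ↥(pbox (fine Lc M')) × Fin (3 + 1) => ((c.1, Sum.inl c.2) : Idx (fine Lc M') (Fib 3))) * fromCols D₂ D₁) := by
    rw [hQ₁₂ h h, Matrix.smul_mul, Matrix.sum_mul]
    refine congrArg _ (Finset.sum_congr rfl fun b _ => ?_)
    rw [Matrix.sum_mul]
    exact Finset.sum_congr rfl fun b' _ => Matrix.smul_mul _ _ _
  have hW₁e : ∀ (b' : ↥(pbox (fine Lc M')) × Fin (3 + 1)) (e : Res (toSite r') Lc M' ⊕ Res (ctr (3 + 1) Lc) Lc (fine Lc M')),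
      W₁ b' e = h b' * -((((Lc : ℝ) ^ (3 + 1) * stepScale 3 Lc j)⁻¹) * Sum.elim (fun t : Res (toSite r') Lc M' => tdelta M' (quo Lc ((b'.1 : Site (3 + 1)) + unitVec b'.2)) t.1)
        (fun s : Res (ctr (3 + 1) Lc) Lc (fine Lc M') => tdelta (fine Lc M') ((b'.1 : Site (3 + 1)) + unitVec b'.2) s.1) e) := fun b' e => by
    rw [hW₁, Matrix.sum_apply]
    simp only [Matrix.smul_apply, Matrix.of_apply, smul_eq_mul]
    rw [Finset.sum_eq_single b' (fun b _ hb => by rw [if_neg (Ne.symm hb), mul_zero]) (fun hb => absurd (Finset.mem_univ b') hb), if_pos rfl]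
  have hQ₁₁e : ∀ (a : ↥(pbox M') × Fin (3 + 1)) (b' : ↥(pbox (fine Lc M')) × Fin (3 + 1)),
      Q₁₁ h a b' = ∑ b : ↥(pbox (fine Lc M')) × Fin (3 + 1), h b
        * perF (fine Lc M') (dper (fine Lc M') (symVhSAt (ctr (3 + 1) Lc) 3 Lc rfl b.2 (b.1 : Site (3 + 1)))) (coarsePt M' Lc a.1, Sum.inr a.2) (b'.1, Sum.inl b'.2) :=
    fun a b' => by rw [hQ₁₁ h, Matrix.sum_apply]; simp only [Matrix.smul_apply, Matrix.submatrix_apply, smul_eq_mul]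
  have hB : ∀ (a : ↥(pbox M') × Fin (3 + 1)) (e : Res (toSite r') Lc M' ⊕ Res (ctr (3 + 1) Lc) Lc (fine Lc M')),
      (Q₁₁ h * W₁) a e = ∑ b' : ↥(pbox (fine Lc M')) × Fin (3 + 1), (∑ b : ↥(pbox (fine Lc M')) × Fin (3 + 1), h b
        * perF (fine Lc M') (dper (fine Lc M') (symVhSAt (ctr (3 + 1) Lc) 3 Lc rfl b.2 (b.1 : Site (3 + 1)))) (coarsePt M' Lc a.1, Sum.inr a.2) (b'.1, Sum.inl b'.2))
        * (h b' * -((((Lc : ℝ) ^ (3 + 1) * stepScale 3 Lc j)⁻¹) * Sum.elim (fun t : Res (toSite r') Lc M' => tdelta M' (quo Lc ((b'.1 : Site (3 + 1)) + unitVec b'.2)) t.1)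
            (fun s : Res (ctr (3 + 1) Lc) Lc (fine Lc M') => tdelta (fine Lc M') ((b'.1 : Site (3 + 1)) + unitVec b'.2) s.1) e)) := fun a e => by
    rw [Matrix.mul_apply]
    exact Finset.sum_congr rfl fun b' _ => by rw [hQ₁₁e, hW₁e]
  have hC : ∀ (a : ↥(pbox M') × Fin (3 + 1)) (e : Res (toSite r') Lc M' ⊕ Res (ctr (3 + 1) Lc) Lc (fine Lc M')),
      (Q₁₀ * W₂) a e = ∑ b : ↥(pbox (fine Lc M')) × Fin (3 + 1), Q₁₀ a b * (((((Lc : ℝ) ^ (3 + 1) * stepScale 3 Lc j)⁻¹) * h b) ^ 2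
        * Sum.elim (fun t : Res (toSite r') Lc M' => tdelta M' (quo Lc ((b.1 : Site (3 + 1)) + unitVec b.2)) t.1)
            (fun s : Res (ctr (3 + 1) Lc) Lc (fine Lc M') => tdelta (fine Lc M') ((b.1 : Site (3 + 1)) + unitVec b.2) s.1) e) := fun a e => by
    rw [Matrix.mul_apply]
    exact Finset.sum_congr rfl fun b _ => by rw [hW₂, Matrix.of_apply]
  have hQ₁₀e : ∀ (a : ↥(pbox M') × Fin (3 + 1)) (b : ↥(pbox (fine Lc M')) × Fin (3 + 1)),
      perF (fine Lc M') (bhKStepSh 3 Lc (Dsh Lc) j) (coarsePt M' Lc a.1, Sum.inr a.2) (b.1, Sum.inl b.2) = Q₁₀ a b := fun a b => by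
    rw [hQ₁₀, Matrix.submatrix_apply]
  ext a e
  rw [Matrix.add_apply, Matrix.add_apply, Matrix.smul_apply, hA, hB, hC, Matrix.smul_apply, Matrix.sum_apply, smul_eq_mul, smul_eq_mul]
  rcases e with t | s
  · -- coarse block columns: all four contact terms; the far root reads `p̄ + e_m`
    simp only [fromCols_apply_inl, Matrix.of_apply, Matrix.sum_apply, Matrix.smul_apply, smul_eq_mul, Matrix.mul_fromCols, Sum.elim_inl]
    rw [Finset.sum_congr rfl fun b _ => Finset.sum_congr rfl fun b' _ => by rw [symQ12_mul_D2_apply M' j hW₁₂ hD₂ b b' a t]]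
    simp only [hQ₁₀e]
    exact c2_entry_algebra h (fun b => tdelta M' (quo Lc ((b.1 : Site (3 + 1)) + unitVec b.2)) t.1) (fun b => Q₁₀ a b)
      (fun b b' => perF (fine Lc M') (dper (fine Lc M') (symVhSAt (ctr (3 + 1) Lc) 3 Lc rfl b.2 (b.1 : Site (3 + 1))))
        (coarsePt M' Lc a.1, Sum.inr a.2) (b'.1, Sum.inl b'.2)) (((Lc : ℝ) ^ (3 + 1) * stepScale 3 Lc j)⁻¹) (tdelta M' ((a.1 : Site (3 + 1)) + unitVec a.2) t.1)
  · -- residual columns: the far-root contact is a root and does not meet a residual parameter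
    have hs : Torus.proj Lc (((s.1 : ↥(pbox (fine Lc M'))) : Site (3 + 1)) - ctr (3 + 1) Lc) ≠ 0 :=
      (ne_rootOf_iff_proj_ne hLc (toSite_mem_range (ctrOff_mem_box hLc1)) s.site).1 s.not_root
    have hroot : tdelta (fine Lc M') ((coarsePt M' Lc a.1 : Site (3 + 1)) + ctr (3 + 1) Lc + (Lc : ℤ) • unitVec a.2) s.1 = 0 :=
      tdelta_far_eq_zero_of_not_root hM' (ctr (3 + 1) Lc) (proj_coarsePt M' Lc a.1) a.2 hs
    have hpair : ∀ b b' : ↥(pbox (fine Lc M')) × Fin (3 + 1),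
        ((perF (fine Lc M') (dper (fine Lc M') (W₁₂ b'.2 (b'.1 : Site (3 + 1)) b.2 (b.1 : Site (3 + 1))))).submatrix
              (fun a : ↥(pbox M') × Fin (3 + 1) => ((coarsePt M' Lc a.1, Sum.inr a.2) : Idx (fine Lc M') (Fib 3)))
              (fun c : ↥(pbox (fine Lc M')) × Fin (3 + 1) => ((c.1, Sum.inl c.2) : Idx (fine Lc M') (Fib 3))) * D₁) a s
          = -(tdelta (fine Lc M') ((b'.1 : Site (3 + 1)) + unitVec b'.2) s.1
                * perF (fine Lc M') (dper (fine Lc M') (symVhSAt (ctr (3 + 1) Lc) 3 Lc rfl b.2 (b.1 : Site (3 + 1)))) (coarsePt M' Lc a.1, Sum.inr a.2) (b'.1, Sum.inl b'.2)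
              + tdelta (fine Lc M') ((b.1 : Site (3 + 1)) + unitVec b.2) s.1
                * perF (fine Lc M') (dper (fine Lc M') (symVhSAt (ctr (3 + 1) Lc) 3 Lc rfl b'.2 (b'.1 : Site (3 + 1)))) (coarsePt M' Lc a.1, Sum.inr a.2) (b.1, Sum.inl b.2)
              - tdelta (fine Lc M') ((b.1 : Site (3 + 1)) + unitVec b.2) s.1 * ((if b = b' then (1 : ℝ) else 0)
                  * ((((Lc : ℝ) ^ (3 + 1) * stepScale 3 Lc j)⁻¹) * perF (fine Lc M') (bhKStepSh 3 Lc (Dsh Lc) j) (coarsePt M' Lc a.1, Sum.inr a.2) (b.1, Sum.inl b.2)))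
              + tdelta (fine Lc M') ((coarsePt M' Lc a.1 : Site (3 + 1)) + ctr (3 + 1) Lc + (Lc : ℤ) • unitVec a.2) s.1
                  * (((((Lc : ℝ) ^ (3 + 1) * stepScale 3 Lc j)⁻¹) * perF (fine Lc M') (bhKStepSh 3 Lc (Dsh Lc) j) (coarsePt M' Lc a.1, Sum.inr a.2) (b.1, Sum.inl b.2))
                    * ((((Lc : ℝ) ^ (3 + 1) * stepScale 3 Lc j)⁻¹) * perF (fine Lc M') (bhKStepSh 3 Lc (Dsh Lc) j) (coarsePt M' Lc a.1, Sum.inr a.2) (b'.1, Sum.inl b'.2)))) :=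
      fun b b' => by subst hD₁; exact symQ12_mul_tgrad_apply M' j hW₁₂ b b' Subtype.val a s
    simp only [fromCols_apply_inr, Matrix.zero_apply, Matrix.sum_apply, Matrix.smul_apply, smul_eq_mul, Matrix.mul_fromCols, Sum.elim_inr]
    rw [Finset.sum_congr rfl fun b _ => Finset.sum_congr rfl fun b' _ => by rw [hpair b b']]
    simp only [hQ₁₀e, hroot]
    exact (c2_entry_algebra h (fun b => tdelta (fine Lc M') ((b.1 : Site (3 + 1)) + unitVec b.2) s.1) (fun b => Q₁₀ a b)
      (fun b b' => perF (fine Lc M') (dper (fine Lc M') (symVhSAt (ctr (3 + 1) Lc) 3 Lc rfl b.2 (b.1 : Site (3 + 1))))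
        (coarsePt M' Lc a.1, Sum.inr a.2) (b'.1, Sum.inl b'.2)) (((Lc : ℝ) ^ (3 + 1) * stepScale 3 Lc j)⁻¹) 0).trans (mul_zero _)

end Summit.QuantumFields.BalabanUV.Beta.FP.PeriodisedSymBorderWardContactTwoInstance

end
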